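import Summits.BirchSwinnertonDyer.Rank1Residual.WAll.AltClosersCMTwoRamifiedFamilies
import Summits.BirchSwinnertonDyer.Rank1Residual.WAll.TargetCMTwoRamifiedOffTYZProved
import Summits.BirchSwinnertonDyer.Rank1Residual.P2.CongruentNumberPairsAtTwoDoorAAtlasThree
import Summits.BirchSwinnertonDyer.Rank1Residual.P2.CongruentClassSevenKernelGenusParity
import Literature.NumberTheory.EllipticCurves.CongruentNumberOddMonskySelmerExact
import Literature.NumberTheory.QuadraticFields.RedeiReichardtFourRank
import HarnessLib

/-!
# Rung W-ALL (D-0120): ALT-CLOSERS BY NAME for the ramified slice of row 12₂ cut by the Tian–Yuan–Zhang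
# families — file 2/2: the U⁺ road (Tian 2014 class 6, the ρ-free TYZ genus class = Tian ICM 2022 Thm 8 per `n`),
# the `ω = 3` atlas (A37 / A37-FJ), and the CLOSERS of the leaves `…TYZUPlus` / `…TYZAtlasFJ`
# (cell `bsd-print-cf2`, D-0131 (2) PRINT TIER, seat p1)

HONEST FRAMING: as in file 1/2 (`WAll/AltClosersCMTwoRamifiedFamilies.lean`) — NOTHING ASSERTED, no `def`,
no `@[conjecture]`, no named fact; the leaf `WAllCornerFTwo` and its ramified slice stay OPEN AS A CLASS;
what closes here are the three FAMILY sub-slices of `WAll/TargetCMTwoRamifiedFamilies.lean`, each modulo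
named facts BY NAME (bsd-wall TYPING-CHECKLIST T10: the facts are antecedents / hypotheses, never asserted):
* `wAllCornerFTwoRamifiedTYZProved_of_facts` — binders TYZ17 Thm 1.2 AS PRINTED, Tian14 Thm 1.3,
  Rédei–Reichardt, LLT24 Thm 1.2, Monsky90 Cor 5.15 (2), GZK (TYZρ only) — model transport FACT-FREE via ty2's
  interface `P2.CornerFTwo.CongruentNumber.*` (p534422) (cell referee 12:49:43Z:
  PROVED-by-name; beyond print: T7, M35, TYZρ YES; LLT, T5 NO);
* `wAllCornerFTwoRamifiedTYZUPlus_of_facts` — binders TYZ17 §3 displayed (`tyz_genusPointData`, ∃-fact: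
  referee books LITERAL-by-name), GZK, Tian14 Thm 1.3 (beyond print YES; RR / HB94-odd DISCHARGED via `_holds`);
* `wAllCornerFTwoRamifiedTYZAtlasFJ_of_facts` — binders TYZ17 Thm 1.2′, GZK ONLY (HB94-odd and RR discharged:
  `HeathBrown1994.monsky_card_selmerGroup_two_odd_holds`, `redeiReichardt_fourTwoCard_classGroup_holds`) — flag-free,
  INSIDE the route's bundle 𝔅_ram (beyond print YES; no A312);
* `wAllCornerFTwoRamifiedTYZProved_of_facts'` — file 1's closer with RR discharged.
With the glue of the statements file, the ramified slice then EQUALS its residual off the TYZ families,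
granted the facts (`wAllCornerFTwoRamified_iff_offTYZ_of_facts`).

The maximal print reach of the p1 road in one statement per road (§7): (ρ-road) square-free
`n ≡ 5, 7 (mod 8)` with `#Sel₂(E_n) = 8` (Tian's `Σ′`), `ρ(n) = 0` and an odd genus sum (`Σ″`) ⟹ `BSD(E_n, 2)`
modulo TYZ Thm 1.2 AS PRINTED + GZK; (U⁺-road) the same WITHOUT `ρ`, for `n ≡ 5, 6, 7 (mod 8)`, modulo the
displayed §3 statements of TYZ (`tyz_genusPointData`, whence the tree's theorem U⁺) + GZK — EXACTLY the
per-`n` content of Tian's ICM 2022 Thm 8. Both beyond print as theorems (the `ρ = 0` step resp. U⁺ are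
not printed statements; p2-lit-1 T1-M15); every input is a published statement typed by name.

References: [TianYuanZhang2017] Thm 1.2, §3; [Tian2023CongruentICM] Thm 8, Thm 13–15; [FaulknerJames2007]
Thm 1.2 (2); [HeathBrown1994SelmerCongruentII] Appendix (Monsky); [Miller2011LMS] Def 1.1; sub-lane «bsd-p2»
doors `P2/CongruentNumberPairsAtTwoRankOneGenus.lean`, `…UPlus.lean`, `…DoorAAtlasThree.lean`,
`…CongruentClassSevenKernelGenusParity.lean`.
-/

noncomputable section

open scoped Classical

open Matrix WeierstrassCurve Literature.NumberTheory.EllipticCurves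
  Literature.NumberTheory.EllipticCurves.Rank1Residual
  Literature.NumberTheory.EllipticCurves.HeathBrown1994
  Literature.NumberTheory.EllipticCurves.TianYuanZhang2017
  Literature.NumberTheory.EllipticCurves.FaulknerJames2007
  Literature.NumberTheory.EllipticCurves.Tian2014
  Literature.NumberTheory.EllipticCurves.LiLiuTian2024
  Literature.NumberTheory.EllipticCurves.Monsky1990
  Literature.NumberTheory.QuadraticFields.RedeiReichardt
  Summit.BirchSwinnertonDyer.Rank1Residual

set_option autoImplicit false

namespace Summit.BirchSwinnertonDyer.Rank1Residual.WAll.PrintCf2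

/-! ## §5 Tian's class-`6` family (BEYOND PRINT: TYZ §3 genus points (U⁺) + Tian Thm 1.3 + Rédei–Reichardt) -/

/-- **SLICE T6 (beyond print, kernel theorem of «bsd-p2», U⁺ road).** For distinct primes `p₀ ≡ 3 (mod 4)`,
`pᵢ ≡ 1 (mod 8)` (`i ≥ 1`) with ODD Legendre graph (`hG`) and `n = ∏ pᵢ` (so `2n ≡ 6 (mod 8)`; Tian 2014
Thm 1.3 with `m = 2n`, Thm 5.2), every globally minimal model `W` of `E_{2n}` satisfies `BSD(W, 2)`. Inputs BY
NAME: the displayed §3 statements of Tian–Yuan–Zhang 2017 (`hTYZ : tyz_genusPointData`, from which the tree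
PROVES the `ρ`-free parity statement U⁺, `W2.uPlus_genusField_of`; at `ρ(2n) = 1` the printed Thm 1.2 alone
decides nothing), GZK (`hGZK`, an input of U⁺), Tian 2014 Thm 1.3 (`h13`), Rédei–Reichardt (`hR`)
(`P2.forall_bsdp_two_congruentNumberCurve_two_mul_caseSix_of_genusPointData` + fact-free transport).
The `2`-part of BSD on this family is NOT a printed theorem (Tian 2014 Rem. 1.4). Beyond print: YES.
[cite: Tian2014, Thm. 1.3, Lemma 5.1, Thm. 5.2, Rem. 1.4 (arXiv:1210.8231 p. 2, p. 28)]
[cite: TianYuanZhang2017, Thm. 1.2, Prop. 3.4, Thm. 3.5 (arXiv:1411.4728 §1, §3)] [cite: LiMa2008, Thm. 0.4 (p. 280)]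
[cite: Miller2011LMS, Def. 1.1] -/
theorem cornerFTwo_tianClassSix (hTYZ : tyz_genusPointData) (hGZK : rank_eq_analyticRank_of_analyticRank_le_one)
    (h13 : thm13_rank_one_and_sha_odd) (hR : redeiReichardt_fourTwoCard_classGroup) :
    ∀ (W : WeierstrassCurve ℚ) [W.IsElliptic] [W.IsGloballyMinimal], W.HasCM → W.analyticRank = 1 →
      ∀ (k : ℕ) (p : Fin (k + 1) → ℕ), (∀ i, (p i).Prime) → Function.Injective p → p 0 % 4 = 3 →
        (∀ i, i ≠ 0 → p i % 8 = 1) → (∀ v, legendreMatrix p *ᵥ v = 0 → v = 0 ∨ v = fun _ => 1) →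
        ∀ (C : VariableChange ℚ), C • congruentNumberCurve (2 * ∏ i, p i) = W → BSDp W 2 := by
  intro W _ _ _ _ k p hp hinj h3 h1 hG C hC
  have hsq : Squarefree (2 * ∏ i, p i) :=
    squarefree_two_mul_prod_of_injective p hp (odd_of_caseSix p h3 h1) hinj
  exact (P2.CornerFTwo.CongruentNumber.analyticRank_eq_one_and_bsdp_two_of_smul hsq
    ⟨(thm13_two_mul_caseSix p h13 hR hp hinj h3 h1 hG rfl).2.1,
      P2.bsdp_two_congruentNumberCurve_two_mul_caseSix_of_genusPointData p hTYZ hGZK h13 hR hp hinj h3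
        h1 hG rfl⟩ hC).2

/-- **Membership (T6).** Every globally minimal model of a class-`6` family twist is a point of the leaf:
CM, analytic rank one (rank from Tian 2014 Thm 1.3 `h13` + `hR`). [cite: Tian2014, Thm. 1.3 with Lemma 5.1 and Thm. 5.2]
[cite: LiMa2008, Thm. 0.4 (p. 280)] -/
theorem hasCM_and_analyticRank_eq_one_of_tianClassSix (h13 : thm13_rank_one_and_sha_odd)
    (hR : redeiReichardt_fourTwoCard_classGroup)
    {k : ℕ} (p : Fin (k + 1) → ℕ) (hp : ∀ i, (p i).Prime) (hinj : Function.Injective p)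
    (h3 : p 0 % 4 = 3) (h1 : ∀ i, i ≠ 0 → p i % 8 = 1)
    (hG : ∀ v, legendreMatrix p *ᵥ v = 0 → v = 0 ∨ v = fun _ => 1)
    {W : WeierstrassCurve ℚ} [W.IsElliptic] [W.IsGloballyMinimal] {C : VariableChange ℚ}
    (hC : C • congruentNumberCurve (2 * ∏ i, p i) = W) : W.HasCM ∧ W.analyticRank = 1 := by
  have hsq : Squarefree (2 * ∏ i, p i) :=
    squarefree_two_mul_prod_of_injective p hp (odd_of_caseSix p h3 h1) hinj
  haveI := isElliptic_congruentNumberCurve hsq.ne_zero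
  haveI := isGloballyMinimal_congruentNumberCurve hsq
  have hiso : IsIsogenous W (congruentNumberCurve (2 * ∏ i, p i)) := by
    rw [← hC]; exact isIsogenous_of_smul _ C
  exact ⟨P2.CornerFTwo.CongruentNumber.hasCM hsq.ne_zero ⟨C, hC⟩,
    by rw [analyticRank_eq_of_isIsogenous' hiso]
       exact (thm13_two_mul_caseSix p h13 hR hp hinj h3 h1 hG rfl).2.1⟩

/-! ## §7b The TYZ genus class on the U⁺ road (tuple-free; `tyz_genusPointData` binder) -/

/-- **THE TYZ GENUS CLASS, `ρ`-FREE (classes `5`, `6`, `7`), tuple-free — U⁺ road.** For square-free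
`n ≡ 5, 6, 7 (mod 8)` with `#Sel₂(E_n) = 8` (`s(n) = 1`) and an odd genus sum (`Σ₁` or `Σ₂′` for
`n ≡ 5, 7`; `Σ₂′` for `n ≡ 6`): `ord_{s=1} L(E_n, s) = 1`, rank `1`, `Ш(E_n)[2^∞] = 0` and **`BSD(E_n, 2)`**,
modulo the displayed §3 statements of Tian–Yuan–Zhang 2017 (`hTYZ : tyz_genusPointData`, whence the tree's
theorem U⁺ `W2.uPlus_genusField_of`) and GZK (the residue class of `n` rides in `hgen`). This is EXACTLY the per-`n` content of Tian's ICM 2022 Thm 8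
(the subset `Σ″ ∩ Σ′` of density `2/3` in `S`), with NO `ρ` hypothesis. Tuple-free twin of «bsd-p2»'s DOOR A /
DOOR B6. Beyond print: YES (assembly; the `ρ`-free parity statement is the tree's theorem from TYZ §3).
[cite: TianYuanZhang2017, Thm. 1.2, Prop. 3.4, Thm. 3.5 (arXiv:1411.4728 §1, §3)] [cite: Tian2023CongruentICM, Thm. 8 (p. 1996), Thm. 13–15 (p. 2000–2001)]
[cite: SilvermanAEC2009, Thm. X.4.2] [cite: Miller2011LMS, Def. 1.1 (arXiv:1010.2431 p. 3)] -/
theorem rankOne_sha_bsdp_two_congruentNumberCurve_of_tyzGenus_uPlus (hTYZ : tyz_genusPointData)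
    (hGZK : rank_eq_analyticRank_of_analyticRank_le_one) {n : ℕ} (hsq : Squarefree n)
    (hsel : haveI := isElliptic_congruentNumberCurve hsq.ne_zero;
      Nat.card ((congruentNumberCurve n).selmerGroup 2) = 8)
    (hgen : ((n % 8 = 5 ∨ n % 8 = 7) ∧
        (Odd (genusSum₁ n fun d => genusClassNumber (GenusField d)) ∨
          Odd (genusSum₂' n fun d => genusClassNumber (GenusField d)))) ∨
      (n % 8 = 6 ∧ Odd (genusSum₂' n fun d => genusClassNumber (GenusField d)))) :
    haveI := isElliptic_congruentNumberCurve hsq.ne_zero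
    (congruentNumberCurve n).analyticRank = 1 ∧ (congruentNumberCurve n).mordellWeilRank = 1 ∧
      AddCommGroup.primaryComponent (congruentNumberCurve n).sha 2 = ⊥ ∧
      BSDp (congruentNumberCurve n) 2 := by
  haveI := isElliptic_congruentNumberCurve hsq.ne_zero
  haveI : Fact (Nat.Prime 2) := ⟨Nat.prime_two⟩
  have hU := P2.uPlus_of_genusPointData hTYZ hGZK
  obtain ⟨Lz, hLodd, hr1, hderiv⟩ : ∃ L : ℤ, Odd L ∧ (congruentNumberCurve n).analyticRank = 1 ∧
      deriv (congruentNumberCurve n).entireLFunction 1 =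
        (2 : ℂ) ^ twoExponent n * (L : ℂ) ^ 2 *
          ((congruentNumberCurve n).realPeriodRat : ℂ) * ((congruentNumberCurve n).regulator : ℂ) := by
    rcases hgen with ⟨h57, hodd⟩ | ⟨h6, hodd⟩
    · exact P2.rankOneDatum_of_uPlus hU hsq h57 hodd
    · exact P2.rankOneDatum_of_uPlus_six hU hsq h6 hodd
  have hx : deriv (congruentNumberCurve n).entireLFunction 1 =
      (((2 : ℚ) ^ twoExponent n * (Lz : ℚ) ^ 2 : ℚ) : ℂ) *
        ((congruentNumberCurve n).realPeriodRat : ℂ) * ((congruentNumberCurve n).regulator : ℂ) := by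
    rw [hderiv]; push_cast; ring
  obtain ⟨hrank, -⟩ := hGZK (congruentNumberCurve n) (le_of_eq hr1)
  rw [hr1] at hrank
  have hbot := P2.primaryComponent_sha_two_eq_bot_of_card_selmerGroup_eq_eight hsq.ne_zero hrank hsel
  refine ⟨hr1, hrank, hbot, ?_⟩
  rw [P2.bsdp_two_iff_of_LDerivOverOmegaReg_of_sha_two_eq_bot_of_torsionOrder_eq_four
    (congruentNumberCurve n) hGZK hr1 hx hbot (torsionOrder_congruentNumberCurve hsq),
    P2.padicValRat_two_zpow_mul_sq hLodd, twoExponent_eq_padicValNat_tamagawaProduct_sub_four hsq]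

/-- **SLICE TYZ-U⁺ (leaf shape).** Every globally minimal model `W` of a member `E_n` of the `ρ`-free TYZ
genus class (square-free `n`, `#Sel₂(E_n) = 8`, and the printed genus condition of Thm 1.2 / ICM Thm 13
for its residue class `n ≡ 5, 7` resp. `6 (mod 8)`) satisfies `BSD(W, 2)`, modulo `hTYZ` (TYZ §3 displayed) and `hGZK` — the per-`n` content of Tian's
ICM 2022 Thm 8. Beyond print: YES.
[cite: TianYuanZhang2017, Thm. 1.2, Thm. 3.5] [cite: Tian2023CongruentICM, Thm. 8 and Thm. 13] [cite: Miller2011LMS, Def. 1.1] -/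
theorem cornerFTwo_tyzGenusUPlus (hTYZ : tyz_genusPointData)
    (hGZK : rank_eq_analyticRank_of_analyticRank_le_one) :
    ∀ (W : WeierstrassCurve ℚ) [W.IsElliptic] [W.IsGloballyMinimal], W.HasCM → W.analyticRank = 1 →
      ∀ (n : ℕ) (hsq : Squarefree n),
        (haveI := isElliptic_congruentNumberCurve hsq.ne_zero;
          Nat.card ((congruentNumberCurve n).selmerGroup 2) = 8) →
        (((n % 8 = 5 ∨ n % 8 = 7) ∧
            (Odd (genusSum₁ n fun d => genusClassNumber (GenusField d)) ∨
              Odd (genusSum₂' n fun d => genusClassNumber (GenusField d)))) ∨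
          (n % 8 = 6 ∧ Odd (genusSum₂' n fun d => genusClassNumber (GenusField d)))) →
        ∀ (C : VariableChange ℚ), C • congruentNumberCurve n = W → BSDp W 2 := by
  intro W _ _ _ _ n hsq hsel hgen C hC
  have h := rankOne_sha_bsdp_two_congruentNumberCurve_of_tyzGenus_uPlus hTYZ hGZK hsq hsel hgen
  exact (P2.CornerFTwo.CongruentNumber.analyticRank_eq_one_and_bsdp_two_of_smul hsq
    ⟨h.1, h.2.2.2⟩ hC).2

/-! ## §8 The `ω(n) = 3` class-`7` family of the «bsd-p2» atlas: `s(n) = 1` ALONE (genus condition automatic) -/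

/-- **SLICE A37 (beyond print; «bsd-p2» `ω = 3` atlas).** For three distinct primes with `p₀p₁p₂ ≡ 7 (mod 8)`
and Monsky's matrix having a `2`-element kernel (`s(n) = 1`; the genus condition of TYZ Thm 1.2 is then
AUTOMATIC, `P2.sigmaCfg_of_card_ker_seven`), every globally minimal model `W` of `E_{p₀p₁p₂}` satisfies
`BSD(W, 2)`, modulo `hTYZ` (TYZ §3 displayed), `hGZK`, `hM` (Monsky 1994, odd case), `hR`
(`P2.rankOne_sha_bsdp_two_congruentNumberCurve_three_primes_seven` + fact-free transport).
Beyond print: YES. [cite: TianYuanZhang2017, Thm. 1.2, Thm. 3.5 and §1 (1.1)]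
[cite: HeathBrown1994SelmerCongruentII, Appendix (Monsky), typescript p. 39 L10–L33] [cite: Miller2011LMS, Def. 1.1] -/
theorem cornerFTwo_threePrimesSeven (hTYZ : tyz_genusPointData)
    (hGZK : rank_eq_analyticRank_of_analyticRank_le_one) (hM : monsky_card_selmerGroup_two_odd)
    (hR : redeiReichardt_fourTwoCard_classGroup) :
    ∀ (W : WeierstrassCurve ℚ) [W.IsElliptic] [W.IsGloballyMinimal], W.HasCM → W.analyticRank = 1 →
      ∀ (p : Fin 3 → ℕ), (∀ i, (p i).Prime) → Function.Injective p → (∏ i, p i) % 8 = 7 →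
        Fintype.card {v : Fin 3 ⊕ Fin 3 → ZMod 2 // monskyMatrixOdd p *ᵥ v = 0} = 2 →
        ∀ (C : VariableChange ℚ), C • congruentNumberCurve (∏ i, p i) = W → BSDp W 2 := by
  intro W _ _ _ _ p hp hinj h7 hker C hC
  have hsq : Squarefree (∏ i, p i) := squarefree_prod_of_injective p hp hinj
  have h := P2.rankOne_sha_bsdp_two_congruentNumberCurve_three_primes_seven p hTYZ hGZK hM hR hp hinj
    rfl h7 hker
  exact (P2.CornerFTwo.CongruentNumber.analyticRank_eq_one_and_bsdp_two_of_smul hsq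
    ⟨h.1, h.2.2.2⟩ hC).2

/-! ## §9 The `ω(n) = 3` class-`7` family on the ρ-ROAD (Faulkner–James kernel `4` ⇒ `ρ = 0`): flag-free binders -/

/-- **SLICE A37-FJ (beyond print; «bsd-p2» p2-monsky-lit, keyed to TYZ Thm 1.2 AS PRINTED).** For three distinct
primes with `p₀p₁p₂ ≡ 7 (mod 8)`, Monsky's matrix with a `2`-element kernel (`s(n) = 1`) AND the Faulkner–James
Laplacian of `G(−n)` with a `4`-element null space (⇒ `ρ(n) = 0`, tree theorem `rhoIndex_eq_one_of_card_ker`;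
⇒ the genus condition, `P2.odd_genusSum_of_card_ker_fjLaplacianNeg_three'`), every globally minimal model `W` of
`E_{p₀p₁p₂}` satisfies `BSD(W, 2)` — modulo `h12` (TYZ Thm 1.2 as printed), `hGZK`, `hM` (Monsky 1994, odd case),
`hR`; NO `tyz_genusPointData` (transport fact-free). Both kernel counts are decided per configuration
by `decide`. (`P2.bsdp_two_congruentNumberCurve_of_card_ker_fj_three'` + §1 of file 1.) Beyond print: YES.
[cite: TianYuanZhang2017, Thm. 1.2 (as printed) and §1 (1.1)] [cite: FaulknerJames2007, Thm. 1.2 (2)]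
[cite: HeathBrown1994SelmerCongruentII, Appendix (Monsky), typescript p. 39 L10–L33] [cite: Miller2011LMS, Def. 1.1] -/
theorem cornerFTwo_threePrimesSevenFJ (h12 : thm12_parity_of_scriptL')
    (hGZK : rank_eq_analyticRank_of_analyticRank_le_one) (hM : monsky_card_selmerGroup_two_odd)
    (hR : redeiReichardt_fourTwoCard_classGroup) :
    ∀ (W : WeierstrassCurve ℚ) [W.IsElliptic] [W.IsGloballyMinimal], W.HasCM → W.analyticRank = 1 →
      ∀ (p : Fin 3 → ℕ), (∀ i, (p i).Prime) → Function.Injective p → (∏ i, p i) % 8 = 7 →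
        Fintype.card {v : Fin 3 ⊕ Fin 3 → ZMod 2 // monskyMatrixOdd p *ᵥ v = 0} = 2 →
        Fintype.card {v : Fin (3 + 1) → ZMod 2 // fjLaplacianNeg p *ᵥ v = 0} = 4 →
        ∀ (C : VariableChange ℚ), C • congruentNumberCurve (∏ i, p i) = W → BSDp W 2 := by
  intro W _ _ _ _ p hp hinj h7 hker hfj C hC
  have hsq : Squarefree (∏ i, p i) := squarefree_prod_of_injective p hp hinj
  -- `ρ(n) = 0` from the Faulkner–James kernel; the genus condition from the same kernel; hence `r_an = 1`
  have hρ : (rhoSubgroup (∏ i, p i)).index = 1 :=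
    rhoIndex_eq_one_of_card_ker p hp hinj (Or.inr h7) hfj rfl
  have hgen := P2.odd_genusSum_of_card_ker_fjLaplacianNeg_three' p hR hp hinj rfl h7 hfj
  obtain ⟨-, -, hr1, -⟩ := rankOneDatum_of_index_eq_one' h12 hsq (Or.inr h7) hρ GenusField
    (isGenusFieldFamily_genusField _) hgen
  have hbsd : BSDp (congruentNumberCurve (∏ i, p i)) 2 :=
    P2.bsdp_two_congruentNumberCurve_of_card_ker_fj_three' p h12 hGZK hM hR hp hinj rfl h7
      (fun i j => addLegendreSym (p j) (p i)) (fun i => addLegendreSym 2 (p i))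
      (fun i => addLegendreSym (-2) (p i)) (fun _ _ => rfl) (fun _ => rfl) (fun _ => rfl) hker hfj
  exact (P2.CornerFTwo.CongruentNumber.analyticRank_eq_one_and_bsdp_two_of_smul hsq
    ⟨hr1, hbsd⟩ hC).2

/-! ## §10 CLOSERS BY NAME of the leaves `WAllCornerFTwoRamifiedTYZUPlus` / `…TYZAtlasFJ`; the residual -/


/-- **The PROVED-road closer with Rédei–Reichardt DISCHARGED** (`redeiReichardt_fourTwoCard_classGroup_holds`):
binders TYZ Thm 1.2′, Tian14 Thm 1.3, LLT24 Thm 1.2, Monsky90 Cor 5.15 (2), GZK only.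
[cite: TianYuanZhang2017, Thm. 1.2] [cite: Tian2014, Thm. 1.3] [cite: LiLiuTian2024, Thm. 1.2]
[cite: Monsky1990MockHeegner, Cor. 5.15 (2)] [cite: LiMa2008, Thm. 0.4] -/
theorem wAllCornerFTwoRamifiedTYZProved_of_facts' (h12 : thm12_parity_of_scriptL')
    (h13 : thm13_rank_one_and_sha_odd) (hLLT : thm12_bsd_congruentNumberCurve)
    (h515 : cor515_rank_eq_one_and_card_selmerGroup_two) (hGZK : rank_eq_analyticRank_of_analyticRank_le_one) :
    WAllCornerFTwoRamifiedTYZProved :=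
  wAllCornerFTwoRamifiedTYZProved_of_facts h12 h13 redeiReichardt_fourTwoCard_classGroup_holds hLLT h515 hGZK

/-- **CLOSER (U⁺ road; LITERAL-by-name per the cell referee, binder `tyz_genusPointData`): the ramified
slice on the U⁺-road TYZ families**, granted TYZ §3 displayed (`hTYZ`), GZK (`hGZK`) and Tian 2014 Thm 1.3
(`h13`, class 6 only) — Rédei–Reichardt and Monsky's odd `2`-Selmer count are DISCHARGED in the tree
(`redeiReichardt_fourTwoCard_classGroup_holds`, `HeathBrown1994.monsky_card_selmerGroup_two_odd_holds`) and no
longer displayed; model transport fact-free.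
[cite: TianYuanZhang2017, Thm. 1.2, Prop. 3.4, Thm. 3.5] [cite: Tian2014, Thm. 1.3 and Thm. 5.2]
[cite: HeathBrown1994SelmerCongruentII, Appendix (Monsky)] [cite: Miller2011LMS, Def. 1.1] -/
theorem wAllCornerFTwoRamifiedTYZUPlus_of_facts (hTYZ : tyz_genusPointData)
    (hGZK : rank_eq_analyticRank_of_analyticRank_le_one) (h13 : thm13_rank_one_and_sha_odd) :
    WAllCornerFTwoRamifiedTYZUPlus := by
  intro W _ _ hcm hr _ hmem
  rcases hmem with ⟨k, p, hp, hinj, h3, h1, hG, C, hC⟩ | ⟨n, hsq, hsel, hgen, C, hC⟩ |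
      ⟨p, hp, hinj, h7, hker, C, hC⟩
  · exact cornerFTwo_tianClassSix hTYZ hGZK h13 redeiReichardt_fourTwoCard_classGroup_holds W hcm hr k p hp
      hinj h3 h1 hG C hC
  · exact cornerFTwo_tyzGenusUPlus hTYZ hGZK W hcm hr n hsq hsel hgen C hC
  · exact cornerFTwo_threePrimesSeven hTYZ hGZK HeathBrown1994.monsky_card_selmerGroup_two_odd_holds
      redeiReichardt_fourTwoCard_classGroup_holds W hcm hr p hp hinj h7 hker C hC

/-- **CLOSER (ρ-road, flag-free binders INSIDE the route's bundle 𝔅_ram): the ramified slice on the `ω = 3` FJ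
atlas**, granted ONLY TYZ Thm 1.2 AS PRINTED (`h12`) and GZK (`hGZK`) — Monsky's odd count and Rédei–Reichardt
are discharged (`_holds`); transport fact-free.
[cite: TianYuanZhang2017, Thm. 1.2 (as printed)] [cite: FaulknerJames2007, Thm. 1.2 (2)]
[cite: HeathBrown1994SelmerCongruentII, Appendix (Monsky)] [cite: Miller2011LMS, Def. 1.1] -/
theorem wAllCornerFTwoRamifiedTYZAtlasFJ_of_facts (h12 : thm12_parity_of_scriptL')
    (hGZK : rank_eq_analyticRank_of_analyticRank_le_one) : WAllCornerFTwoRamifiedTYZAtlasFJ := by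
  intro W _ _ hcm hr _ ⟨p, hp, hinj, h7, hker, hfj, C, hC⟩
  exact cornerFTwo_threePrimesSevenFJ h12 hGZK HeathBrown1994.monsky_card_selmerGroup_two_odd_holds
    redeiReichardt_fourTwoCard_classGroup_holds W hcm hr p hp hinj h7 hker hfj C hC

/-- **THE RAMIFIED SLICE IS ITS RESIDUAL, granted the facts**: with the p1 binders {TYZ Thm 1.2′, Tian14
Thm 1.3, LLT24 Thm 1.2, Monsky90 Cor 5.15 (2), TYZ §3 displayed, GZK} in hand (RR, HB94 discharged),
`WAllCornerFTwoRamified ↔ WAllCornerFTwoRamifiedOffTYZ` — the TYZ families are carved out of row 12₂'s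
ramified slice BY NAME. [folklore] -/
theorem wAllCornerFTwoRamified_iff_offTYZ_of_facts (h12 : thm12_parity_of_scriptL')
    (h13 : thm13_rank_one_and_sha_odd) (hLLT : thm12_bsd_congruentNumberCurve)
    (h515 : cor515_rank_eq_one_and_card_selmerGroup_two) (hTYZ : tyz_genusPointData)
    (hGZK : rank_eq_analyticRank_of_analyticRank_le_one) :
    WAllCornerFTwoRamified ↔ WAllCornerFTwoRamifiedOffTYZ :=
  wAllCornerFTwoRamified_iff_offTYZ_of_families
    (wAllCornerFTwoRamifiedTYZProved_of_facts h12 h13 redeiReichardt_fourTwoCard_classGroup_holds hLLT h515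
      hGZK)
    (wAllCornerFTwoRamifiedTYZUPlus_of_facts hTYZ hGZK h13)
    (wAllCornerFTwoRamifiedTYZAtlasFJ_of_facts h12 hGZK)

/-- **Row 12₂ from its OPEN parts, granted the p1 facts and LTYZ25**: `WAllCornerFTwo` follows from the
split-bad slice, the ramified residual off the TYZ families, and the two inert slices (the split-good slice
is Li–Tian–Yan–Zhu 2025, `wAllCornerFTwoSplitGood_of_ltyz`). The deciding-theorem shape of a print route
closing the leaf with the TYZ families carved out. [folklore] -/
theorem wAllCornerFTwo_of_openSlices_offTYZ (hLTYZ : LiTianYanZhu2025.thm11_bsdp_of_cm_rank_one)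
    (h12 : thm12_parity_of_scriptL') (h13 : thm13_rank_one_and_sha_odd)
    (hLLT : thm12_bsd_congruentNumberCurve) (h515 : cor515_rank_eq_one_and_card_selmerGroup_two)
    (hTYZ : tyz_genusPointData) (hGZK : rank_eq_analyticRank_of_analyticRank_le_one)
    (hSB : WAllCornerFTwoSplitBad) (hOff : WAllCornerFTwoRamifiedOffTYZ) (hIG : WAllCornerFTwoInertGood)
    (hIB : WAllCornerFTwoInertBad) : WAllCornerFTwo :=
  wAllCornerFTwo_iff_slices.2 ⟨wAllCornerFTwoSplitGood_of_ltyz hLTYZ, hSB,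
    (wAllCornerFTwoRamified_iff_offTYZ_of_facts h12 h13 hLLT h515 hTYZ hGZK).2 hOff, hIG, hIB⟩

/-- **The flag-free residual REDUCES to the four-way residual, granted the U⁺-road facts**: with TYZ §3
displayed (`hTYZ`), GZK, Tian14 Thm 1.3 and TYZ Thm 1.2′ in hand (RR and Monsky 1994 odd discharged),
`WAllCornerFTwoRamifiedOffTYZ → WAllCornerFTwoRamifiedOffTYZProved` — the LITERAL families are carved out of
the route's flag-free residual by name (the shape of an `…OfFactsPlus` twin's glue). [folklore] -/
theorem wAllCornerFTwoRamifiedOffTYZProved_of_facts_of_offTYZ (hTYZ : tyz_genusPointData)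
    (hGZK : rank_eq_analyticRank_of_analyticRank_le_one) (h13 : thm13_rank_one_and_sha_odd)
    (h12 : thm12_parity_of_scriptL') (hO : WAllCornerFTwoRamifiedOffTYZ) :
    WAllCornerFTwoRamifiedOffTYZProved :=
  wAllCornerFTwoRamifiedOffTYZProved_of_uPlus_of_atlasFJ_of_offTYZ
    (wAllCornerFTwoRamifiedTYZUPlus_of_facts hTYZ hGZK h13) (wAllCornerFTwoRamifiedTYZAtlasFJ_of_facts h12 hGZK) hO

end Summit.BirchSwinnertonDyer.Rank1Residual.WAll.PrintCf2





end
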